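import Literature.NumberTheory.GelbartRogawski1991.Prop311AdelicCoordinates
import Literature.NumberTheory.GelbartRogawski1991.Prop311RationalSplittingUnique
import Literature.NumberTheory.Weil1964.AdelicSchrodingerL2Dense
import HarnessLib

/-!
# [GelbartRogawski1991, §3.1 p. 454 L19–21]: the printed `ρ_ψ` realised on `L²(𝐀_Fⁿ)` — the `L²` MODEL of the
# irreducible unitary representation of `H_𝐀(W)` with central character `ψ`, for exactly the objects of `Prop311AsPrinted`

Topic `NumberTheory/GelbartRogawski1991`; namespace `Literature.NumberTheory.GelbartRogawski1991.Prop311` (the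
namespace of the auxiliary objects of the statement-exact typing `Prop311AsPrinted`).  KERNEL ONLY: theorems; no
definition, no named fact, no `sorry`; `Prop311AsPrinted` itself is untouched (nothing of it is assumed or asserted).

`Prop311AsPrinted` quantifies over "an irreducible unitary representation `ρ_ψ` of `H_𝐀(W)` with central character `ψ`"
— binders `S ρ _hρu _hρc _hρi _hρz` — for `H_𝐀(W) = Prop311.AdelicHeisenberg F E V Φ`, the Heisenberg group of
`W_𝐀 = 𝐀 ⊗_F V` with the law `½ φ_𝐀`, `φ = Tr_{E/F} Φ` ([GelbartRogawski1991, §3.1 p. 454 L17–21]).  This file INHABITS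
those binders with the `L²` MODEL: in adelic Darboux coordinates `e : 𝐀ⁿ × 𝐀ⁿ ≃ W_𝐀` (`Prop311AdelicCoordinates`,
`φ_𝐀` standard) the group `H_𝐀(W)` maps ONTO Weil's polarised adelic Heisenberg group
`Weil1964.AdelicHeisenberg F (Fin n) 1` (`(w, t) ↦ ((x, y), t + ½ x·y)`, `(x, y) = e⁻¹ w`; `HeisenbergCoboundary`), and
the Schrödinger representation `SchrodingerHaar.rep` of the latter on `L²(𝐀_Fⁿ, ν)` (`SchrodingerL2Haar`) pulls back to

**`rho_exists_L2`**: a Hilbert space `S = L²(𝐀_Fⁿ, ν)` (`ν` a Haar measure) and `ρ : H_𝐀(W) → U(S)` with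
`‖ρ(h) f‖ = ‖f‖`, continuous orbit maps for `heisenbergTopology`, NO closed invariant subspace other than `⊥`, `⊤`
(`Weil1964.adelicSchrodingerL2_irreducible_one`), central character `ψ`, TOGETHER WITH the surjection
`p : H_𝐀(W) ↠ Weil1964.AdelicHeisenberg F (Fin n) 1` along which `ρ = ρ_{L²} ∘ p` — so that this model is the `L²`
completion of the tree's smooth Schrödinger model `Weil1964.adelicSchrodinger F (Fin n) 1` on `𝒮(𝐀_Fⁿ)`
(`Weil1964.AdelicSchrodingerL2Dense`: dense and equivariant).  Companion of `Prop311RhoPsiExists` (the lattice ⊗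
Schrödinger model) and `Prop311RhoPsiUnique` (any two such models are unitarily equivalent).

## References
* [GelbartRogawski1991] S. Gelbart, J. Rogawski, Invent. Math. 105 (1991), §3.1 p. 454 L17–22, p. 455 L1–2.
* [Weil1964] A. Weil, Acta Math. 111 (1964), Chap. I n° 4 p. 149, n° 11–13.
* [MoeglinVignerasWaldspurger1987] C. Mœglin, M.-F. Vignéras, J.-L. Waldspurger, LNM 1291 (1987), Chap. 2 I.1–I.4.
-/

set_option autoImplicit false

noncomputable section

open MeasureTheory Filter Set NumberField IsDedekindDomain
open scoped ENNReal Topology Matrix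
open Literature.RepresentationTheory.HeisenbergGroup Literature.NumberTheory.Automorphic Literature.NumberTheory.Weil1964

namespace Literature.NumberTheory.GelbartRogawski1991

namespace Prop311

attribute [local instance] secondCountableTopology_adeleRing locallyCompactSpace_adeleRing'

/-- **THE `L²` MODEL OF THE PRINTED `ρ_ψ`.**  For the data of `Prop311AsPrinted` — `F` a number field, `E/F` quadratic
with `σ`, `ψ` a continuous character of `𝐀_F` trivial on `F` and `≠ 1`, `(V, Φ)` skew-Hermitian with `φ = Tr Φ`
non-degenerate — there are `n`, a Haar measure `ν` on `𝐀_Fⁿ`, a representation `ρ` of `H_𝐀(W) = AdelicHeisenberg F E V Φ`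
on the Hilbert space `L²(𝐀_Fⁿ, ν)` by linear ISOMETRIES with CONTINUOUS orbit maps (topology `heisenbergTopology`), NO
closed invariant subspace other than `⊥`, `⊤`, and CENTRAL CHARACTER `ψ` — i.e. the binders
`S ρ _hρu _hρc _hρi _hρz` of `Prop311AsPrinted` are inhabited by `S = L²(𝐀_Fⁿ)` — and a surjective homomorphism
`p : H_𝐀(W) ↠ Weil1964.AdelicHeisenberg F (Fin n) 1` (adelic Darboux coordinates followed by `(w, t) ↦ (w, t + ½ x·y)`)
with `ρ = SchrodingerHaar.rep (adelicForm F (Fin n) 1) ψ … ν ∘ p`, and the classes of the Schwartz–Bruhat functions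
`𝒮(𝐀_Fⁿ) = piSchwartzBruhat F (Fin n)` are DENSE in `L²(𝐀_Fⁿ, ν)`: this `ρ` is the `L²` completion of Weil's smooth
Schrödinger model on `𝒮(𝐀_Fⁿ)`. [cite: GelbartRogawski1991, §3.1 p. 454 L17–21] [cite: Weil1964, Chap. I n° 11] -/
theorem rho_exists_L2 (F : Type) [Field F] [NumberField F]
    (E : Type) [Field E] [Algebra F E] [Algebra.IsQuadraticExtension F E] (σ : E ≃ₐ[F] E)
    (ψ : AddChar (AdeleRing (𝓞 F) F) Circle) (hψc : Continuous ψ)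
    (hψF : ∀ x : F, ψ (algebraMap F (AdeleRing (𝓞 F) F) x) = 1) (hψ1 : ψ ≠ 1)
    (V : Type) [AddCommGroup V] [Module F V] [Module E V] [IsScalarTower F E V] [FiniteDimensional E V]
    (Φ : V →ₗ[F] V →ₗ[F] E) (hΦ₃ : ∀ x y : V, Φ y x = -σ (Φ x y)) (hφ : (traceForm F E V Φ).Nondegenerate)
    [MeasurableSpace (AdeleRing (𝓞 F) F)] [BorelSpace (AdeleRing (𝓞 F) F)] :
    ∃ (n : ℕ) (ν : Measure (Fin n → AdeleRing (𝓞 F) F)) (_ : ν.IsAddHaarMeasure)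
      (ρ : Representation ℂ (AdelicHeisenberg F E V Φ) (Lp ℂ 2 ν))
      (p : AdelicHeisenberg F E V Φ →* Weil1964.AdelicHeisenberg F (Fin n) 1),
      (∀ (h : AdelicHeisenberg F E V Φ) (f : Lp ℂ 2 ν), ‖ρ h f‖ = ‖f‖) ∧
      (∀ f : Lp ℂ 2 ν, @Continuous _ _ (heisenbergTopology F E V Φ) _ fun h => ρ h f) ∧
      (∀ K : Submodule ℂ (Lp ℂ 2 ν), IsClosed (K : Set (Lp ℂ 2 ν)) →
        (∀ (h : AdelicHeisenberg F E V Φ), ∀ f ∈ K, ρ h f ∈ K) → K = ⊥ ∨ K = ⊤) ∧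
      (∀ (t : AdeleRing (𝓞 F) F) (f : Lp ℂ 2 ν),
        ρ (Heisenberg.ofCenter (heisForm F E V Φ) (Multiplicative.ofAdd t)) f = ((ψ t : Circle) : ℂ) • f) ∧
      Function.Surjective p ∧
      (∀ (h : AdelicHeisenberg F E V Φ) (f : Lp ℂ 2 ν),
        ρ h f = SchrodingerHaar.rep (adelicForm F (Fin n) 1) ψ hψc (continuous_adelicForm_left F (Fin n) 1) ν (p h) f) ∧
      Dense {f : Lp ℂ 2 ν | ∃ Φ ∈ piSchwartzBruhat F (Fin n), (f : (Fin n → AdeleRing (𝓞 F) F) → ℂ) =ᵐ[ν] Φ} := by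
  classical
  haveI : FiniteDimensional F V := finite_restrictScalars F E V
  have hψ : IsGlobalAddChar F ψ := ⟨hψc, hψF, hψ1⟩
  -- adelic Darboux coordinates
  obtain ⟨n, e, he⟩ := exists_adelicDarboux F E V Φ (isAlt_traceForm F E V Φ σ hΦ₃) hφ
  haveI : BorelSpace (Fin n → AdeleRing (𝓞 F) F) := Pi.borelSpace
  -- the measure and the `L²` Schrödinger representation of the polarised group
  set ν : Measure (Fin n → AdeleRing (𝓞 F) F) := Measure.addHaarMeasure (Classical.arbitrary _) with hν
  haveI : ν.IsAddHaarMeasure := by rw [hν]; infer_instance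
  set β : (Fin n → AdeleRing (𝓞 F) F) →ₗ[AdeleRing (𝓞 F) F] (Fin n → AdeleRing (𝓞 F) F) →ₗ[AdeleRing (𝓞 F) F]
      AdeleRing (𝓞 F) F := adelicForm F (Fin n) 1 with hβ
  have hβ₁ : ∀ x y, β x y = x ⬝ᵥ y := fun x y => adelicForm_one_apply x y
  have hβc : ∀ y, Continuous fun u : Fin n → AdeleRing (𝓞 F) F => β u y := continuous_adelicForm_left F (Fin n) 1
  have hβc' : ∀ u, Continuous fun y : Fin n → AdeleRing (𝓞 F) F => β u y := fun u => by
    simp only [hβ₁]; exact continuous_const.dotProduct continuous_id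
  set ρ₀ := SchrodingerHaar.rep β ψ hψc hβc ν with hρ₀
  -- the surjection `p : H_𝐀(W) → Heisenberg (polar β)`: coordinates, then the coboundary `t ↦ t + ½ x·y`
  let j : AdelicSpace F V →+ (Fin n → AdeleRing (𝓞 F) F) × (Fin n → AdeleRing (𝓞 F) F) :=
    e.symm.toLinearMap.toAddMonoidHom
  have hj : ∀ w, j w = e.symm w := fun w => rfl
  have hjk : ∀ v w : AdelicSpace F V,
      ((⅟(2 : AdeleRing (𝓞 F) F)) • altPolar β) (j v) (j w) = (AddMonoidHom.id _) (heisForm F E V Φ v w) := by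
    intro v w
    rw [AddMonoidHom.id_apply, hj, hj, LinearMap.smul_apply, LinearMap.smul_apply, altPolar_apply, hβ₁, hβ₁,
      smul_eq_mul]
    have h := heisForm_coord he (e.symm v) (e.symm w)
    rw [LinearEquiv.apply_symm_apply, LinearEquiv.apply_symm_apply] at h
    rw [h]
  let m : AdelicHeisenberg F E V Φ →* Heisenberg ((⅟(2 : AdeleRing (𝓞 F) F)) • altPolar β) :=
    Heisenberg.map _ j (AddMonoidHom.id _) hjk
  let p : AdelicHeisenberg F E V Φ →* Weil1964.AdelicHeisenberg F (Fin n) 1 :=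
    (halfAltPolarEquiv β).toMonoidHom.comp m
  have hp : ∀ h : AdelicHeisenberg F E V Φ,
      p h = ⟨e.symm h.v, h.t + ⅟(2 : AdeleRing (𝓞 F) F) * β (e.symm h.v).1 (e.symm h.v).2⟩ := fun h => rfl
  have hpsurj : Function.Surjective p := fun g => by
    refine ⟨⟨e g.v, g.t - ⅟(2 : AdeleRing (𝓞 F) F) * β g.v.1 g.v.2⟩, ?_⟩
    rw [hp]
    apply Heisenberg.ext
    · exact e.symm_apply_apply g.v
    · change g.t - ⅟(2 : AdeleRing (𝓞 F) F) * β g.v.1 g.v.2 +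
          ⅟(2 : AdeleRing (𝓞 F) F) * β (e.symm (e g.v)).1 (e.symm (e g.v)).2 = g.t
      rw [LinearEquiv.symm_apply_apply, sub_add_cancel]
  have hpz : ∀ t : AdeleRing (𝓞 F) F, p (Heisenberg.ofCenter (heisForm F E V Φ) (Multiplicative.ofAdd t)) =
      Heisenberg.ofCenter (polar β) (Multiplicative.ofAdd t) := fun t => by
    change halfAltPolarEquiv β (m (Heisenberg.ofCenter (heisForm F E V Φ) (Multiplicative.ofAdd t))) = _
    rw [Heisenberg.map_ofCenter hjk, AddMonoidHom.id_apply, halfAltPolarEquiv_ofCenter]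
  -- continuity of `p` from `heisenbergTopology` to `(𝐀ⁿ × 𝐀ⁿ) × 𝐀`
  letI tW : TopologicalSpace (AdelicSpace F V) := adelicSpaceTopology F V
  letI tH : TopologicalSpace (AdelicHeisenberg F E V Φ) := heisenbergTopology F E V Φ
  haveI : IsModuleTopology (AdeleRing (𝓞 F) F) (AdelicSpace F V) := ⟨rfl⟩
  have hesymm : Continuous (e.symm : AdelicSpace F V → (Fin n → AdeleRing (𝓞 F) F) × (Fin n → AdeleRing (𝓞 F) F)) :=
    IsModuleTopology.continuous_of_linearMap e.symm.toLinearMap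
  have hpc : Continuous fun h : AdelicHeisenberg F E V Φ =>
      ((e.symm h.v, h.t + ⅟(2 : AdeleRing (𝓞 F) F) * β (e.symm h.v).1 (e.symm h.v).2) :
        ((Fin n → AdeleRing (𝓞 F) F) × (Fin n → AdeleRing (𝓞 F) F)) × AdeleRing (𝓞 F) F) := by
    have hv : Continuous fun h : AdelicHeisenberg F E V Φ => h.v :=
      continuous_heisenberg_v (heisForm F E V Φ) (adelicSpaceTopology F V) inferInstance
    have ht : Continuous fun h : AdelicHeisenberg F E V Φ => h.t :=
      continuous_heisenberg_t (heisForm F E V Φ) (adelicSpaceTopology F V) inferInstance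
    have hw : Continuous fun h : AdelicHeisenberg F E V Φ => e.symm h.v := hesymm.comp hv
    have hd : Continuous fun c : (Fin n → AdeleRing (𝓞 F) F) × (Fin n → AdeleRing (𝓞 F) F) => β c.1 c.2 := by
      simp only [hβ₁]; exact continuous_fst.dotProduct continuous_snd
    exact hw.prodMk (ht.add (continuous_const.mul (hd.comp hw)))
  refine ⟨n, ν, inferInstance, ρ₀.comp p, p, fun h f => SchrodingerHaar.norm_rep_apply β ψ hψc hβc ν _ f,
    fun f => ?_, fun K hKc hK => ?_, fun t f => ?_, hpsurj, fun h f => rfl, dense_piSchwartzBruhat F (Fin n) ν⟩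
  · -- continuity of the orbit maps
    have hc := SchrodingerHaar.continuous_rep_mk β ψ hψc hβc ν hβc' f
    have e1 : (fun h : AdelicHeisenberg F E V Φ => (ρ₀.comp p) h f) = (fun q : ((Fin n → AdeleRing (𝓞 F) F) ×
        (Fin n → AdeleRing (𝓞 F) F)) × AdeleRing (𝓞 F) F => ρ₀ ⟨q.1, q.2⟩ f) ∘ fun h : AdelicHeisenberg F E V Φ =>
          ((e.symm h.v, h.t + ⅟(2 : AdeleRing (𝓞 F) F) * β (e.symm h.v).1 (e.symm h.v).2) :
            ((Fin n → AdeleRing (𝓞 F) F) × (Fin n → AdeleRing (𝓞 F) F)) × AdeleRing (𝓞 F) F) := by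
      funext h
      rw [MonoidHom.coe_comp, Function.comp_apply, hp]
      rfl
    rw [e1]
    exact hc.comp hpc
  · -- irreducibility, from the polarised group through the surjection `p`
    refine adelicSchrodingerL2_irreducible_one F (Fin n) ψ hψ ν K hKc fun g f hf => ?_
    obtain ⟨h, rfl⟩ := hpsurj g
    exact hK h f hf
  · -- the central character
    rw [MonoidHom.coe_comp, Function.comp_apply, hpz, hρ₀, SchrodingerHaar.rep_ofCenter]

end Prop311

end Literature.NumberTheory.GelbartRogawski1991

end
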